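import Mathlib.Analysis.Calculus.Deriv.MeanValue
import Mathlib.Analysis.SpecialFunctions.Pow.Deriv
import Mathlib.Analysis.SpecialFunctions.Pow.Asymptotics
import Mathlib.Topology.Order.LeftRightNhds
import Literature.Barriers.CriticalPhenomena.RigorousRGSmallParameter
import HarnessLib

/-!
# `RigorousRGSmallParameter` (Slade, Theorem 1.4.1): proof architecture and the proved top layer

Companion to `Literature/Barriers/CriticalPhenomena/RigorousRGSmallParameter.lean`, whose barrier
`RigorousRGSmallParameter` is literally `LongRangePhi4.Slade2017_thm141` (Slade, CMP 358 (2018),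
arXiv:1611.06169, Theorem 1.4.1, first display, spin case `n ≥ 1`). (The sibling
`RigorousRGSmallParameterProofs.lean` discharges the barrier file's other named fact,
`IsingIsStrongCouplingLimit`; this file, `RigorousRGSmallParameterSladeReduction.lean`, concerns
`Slade2017_thm141` only.)

## Size of a full discharge

Theorem 1.4.1 is the output of the Bauerschmidt–Brydges–Slade rigorous renormalisation group.
Its printed proof (§2–§11 of the paper) runs: §2 fractional Laplacian (Lemma 2.1.1 kernel decay,
Lemma 2.1.2 and Proposition 2.1.3 subordination of the resolvent, Lemma 2.2.1 generator property,
Lemma 2.2.2 torus inverses by periodisation, `((-Δ)^β + m²)⁻¹𝟙 = m⁻²𝟙`); §3 finite-range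
decomposition `((-Δ_Λ)^{α/2} + m²)⁻¹ = Σ_{j<N} C_j + C_{N,N}` with the estimates of
Proposition 3.3.1 (from [Baue13a], [Mitt16], corrected in §10); §4 progressive Gaussian
integration `Z_{j+1} = E_{C_{j+1}}θZ_j`, `χ_N(g, ν₀ + m²) = χ̂_N(m², g, ν₀)`; §5 second-order
perturbation theory (Proposition 5.1.1 from [BBS-rg-pt], coefficient bounds Lemmas 5.2.1–5.2.4,
the change of variables Proposition 5.3.1, the perturbative fixed point `s̄ = a⁻¹(1 - L^{-ε})`,
`a = lim_j β_j(0)`, §5.4); §6 the non-perturbative coordinate `K_j`, the `T_φ`/`𝒲` norms and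
the renormalisation group step map Theorem 6.3.1 (the main result of [BS-rg-step], itself resting
on [BS-rg-norm], [BS-rg-loc], [BS-rg-IE], adapted); §7 the global flow: Theorem 7.2.2 (the map
`T` is a contraction, giving the critical initial condition `μ₀(m²)`), Corollaries 7.2.4–7.2.5,
Lemma 7.2.7, Theorem 7.3.1 (flow beyond the mass scale, `g_∞`, `ν_∞`); §8 Lemma 8.1.1–Corollary
8.1.6 (derivatives of the flow in `ν₀`), Lemma 8.2.1 (`χ̂_N = m⁻² + m⁻⁴|Λ_N|⁻¹D²Z_N(0;𝟙,𝟙)/Z_N(0)`),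
Proposition 8.2.2 (`χ̂ = m⁻² - ν_∞m⁻⁴ = m⁻²(1 + O(s̄))`, `χ̂' = -ν'_∞m⁻⁴ ≍ -m^{-4+2γ̂ε/α+O(ε²)}`,
`γ̂ = (n+2)/(n+8)`), the differential inequality
`-χ(ν*)^{-2+γ̂ε/α+O(ε²)} ∂χ/∂ν(ν*) ≍ 1` on the critical curve `ν* = ν₀ᶜ(m²) + m²` (second
display after Remark 8.2.3), Theorem 8.3.1
(`ν_c = lim_{m²↓0} ν*(m²)` is the critical value, `χ ↑ ∞` as `ν ↓ ν_c`, and the set of `ν*` is a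
closed interval `[ν_c, ν_c + η]`, `η > 0`), and finally ("Proof of Theorem 1.4.1", end of §8.3)
the integration of the differential inequality over `[λ, ν]` with `λ ↓ ν_c`, which yields
`χ(ν) ≍ (ν - ν_c)^{-(1 + γ̂ε/α + O(ε²))}`. Everything above Theorem 8.3.1 — Proposition 8.2.2
and the first display after Remark 8.2.3, i.e. the output of the flow — needs the Banach spaces
of polymer activities of [BS-rg-norm]/[BS-rg-step]; a discharge of the barrier is therefore the
formalisation of that theory (triage: XL) and is not attempted. (Theorem 8.3.1 itself is soft
topology given that output: it is proved — and the named fact below is derived from the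
`m²`-parametrised output `Slade2017_criticalCurve` — in the companion
`RigorousRGSmallParameterCriticalPoint.lean`, which imports this file.)

## What this file does

* `LongRangePhi4.Slade2017_susceptibilityDiffIneq` — named fact (not proved): the conclusions of
  §8.2–§8.3 that the final step consumes, stated with the objects of the barrier file
  (`HasSusceptibility`): on a right neighbourhood `(ν_c, ν_c + η]` of the critical value the
  infinite-volume susceptibility `χ(g, ν; n)` exists (Proposition 8.2.2 with Theorem 8.3.1), is
  differentiable in `ν` with `χ̂'` "in fact the derivative of `χ̂`" (Proposition 8.2.2), is positive
  (`χ̂ = m⁻²(1 + O(s̄))`), satisfies `-χ^{-2+γ̂ε/α+O(ε²)} ∂χ/∂ν ≍ 1` (the second display after Remark 8.2.3)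
  and diverges as `ν ↓ ν_c` (Theorem 8.3.1); with the same quantifier prefix and the
  same reading of the constants (uniform in `ε`, `g`, `t`; dependent on `d`, `n`, `L`) as
  `Slade2017_thm141`.
* `LongRangePhi4.le_rpow_of_deriv_rpow_le`, `LongRangePhi4.rpow_le_of_le_deriv_rpow` — the
  generic calculus of the last step, PROVED: a one-sided bound on `-χ' χ^{-(1+p)}` on an interval
  `(a, b)` integrates to a one-sided power-law bound on `χ` in `x - a` (the lower bound on `χ` uses
  `χ → ∞` at `a⁺`).
* `LongRangePhi4.Slade2017_thm141_of_susceptibilityDiffIneq` and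
  `rigorousRGSmallParameter_of_susceptibilityDiffIneq` — PROVED: Theorem 1.4.1 (hence the
  barrier) from the named fact, i.e. Slade's "Proof of Theorem 1.4.1" paragraph, including the
  bookkeeping `1/(1 - γ̂ε/α ∓ Cε²) = 1 + γ̂ε/α + O(ε²)` with explicit constants
  (`C' = 4C² + C + 17` after shrinking `ε₀` to `min ε₀ (1/8) (1/(4C))`).
* `LongRangePhi4.powerLaw_analytic_clauses`, `LongRangePhi4.powerLaw_clauses_literal` — PROVED
  (barrier audit, D-0021): the analytic clauses (ii)–(iv) of the named fact are jointly
  satisfiable in their literal shape by the power law `χ(ν) = (ν - ν_c)^{-1/(1-θ)}`,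
  `θ = γ̂ε/α`, with ONE constant chosen before `ε` (`C = 2` serves every `ε ≤ 1/4`), and
  `-χ^{-2+θ}χ' ≡ const` forces the exponent `1/(1-θ) = 1 + θ + O(θ²)` of Theorem 1.4.1 — a
  non-vacuity certificate for the hypothesis of the reduction (clause (i), the model, is not
  touched; the full fact is the printed content of Proposition 8.2.2 / Theorem 8.3.1).

Display numbers of the arXiv version are not legible in the held text; displays are located by
theorem and order, as in the barrier file. Page loci in the held arXiv text (PDF pages):
Theorem 1.4.1 and "first `L` is chosen large, and then `ε` is chosen small depending on `L`" —
p. 6; the constants convention "for some positive `δ` and `c`, and for all `ε ∈ (0,δ]` and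
`j ≥ 1`" (§8.1, the reading of `O(ε²)` used for `C` uniform in `ε`) — p. 33; Proposition 8.2.2
and "the limit and derivative can be interchanged" — p. 36; the two displays after Remark 8.2.3,
Theorem 8.3.1 with its proof, and "Proof of Theorem 1.4.1" — p. 37.
-/

noncomputable section

namespace Literature.Barriers.CriticalPhenomena

open MeasureTheory Filter Topology Set
open scoped BigOperators

namespace LongRangePhi4

/-! ### Generic calculus: integrating a one-sided bound on `-χ' χ^{-(1+p)}` -/

/-- If `χ > 0` is differentiable on `(a, b)` and `K ≤ -χ'(x) χ(x)^{-(1+p)}` there (`p, K > 0`), then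
`χ(x) ≤ (pK(x - a))^{-1/p}` on `(a, b)`: the function `χ^{-p}` has derivative `≥ pK` and is
positive, so `χ(x)^{-p} ≥ pK(x - a)`. This is the upper-bound half of the last step of the proof
of Slade's Theorem 1.4.1 ("Integration of [the differential inequality] over the interval
`[λ, ν]`").
[cite: Slade2017, §8.3, Proof of Theorem 1.4.1] -/
theorem le_rpow_of_deriv_rpow_le {χ : ℝ → ℝ} {a b p K : ℝ} (hp : 0 < p) (hK : 0 < K)
    (hdiff : DifferentiableOn ℝ χ (Ioo a b)) (hpos : ∀ x ∈ Ioo a b, 0 < χ x)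
    (hineq : ∀ x ∈ Ioo a b, K ≤ -(deriv χ x * χ x ^ (-(1 + p)))) :
    ∀ x ∈ Ioo a b, χ x ≤ (p * K * (x - a)) ^ (-(1 / p)) := by
  set ψ : ℝ → ℝ := fun x => χ x ^ (-p) with hψ
  have hderiv : ∀ x ∈ Ioo a b, HasDerivAt ψ (deriv χ x * (-p) * χ x ^ (-p - 1)) x :=
    fun x hx =>
      ((hdiff x hx).differentiableAt (Ioo_mem_nhds hx.1 hx.2)).hasDerivAt.rpow_const
        (Or.inl (hpos x hx).ne')
  have hψdiff : DifferentiableOn ℝ ψ (Ioo a b) := fun x hx =>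
    (hderiv x hx).differentiableAt.differentiableWithinAt
  have hψ' : ∀ x ∈ interior (Ioo a b), p * K ≤ deriv ψ x := by
    rw [interior_Ioo]
    intro x hx
    rw [(hderiv x hx).deriv]
    have h2 : deriv χ x * (-p) * χ x ^ (-p - 1) = p * -(deriv χ x * χ x ^ (-(1 + p))) := by
      rw [show -p - 1 = -(1 + p) by ring]
      ring
    rw [h2]
    exact mul_le_mul_of_nonneg_left (hineq x hx) hp.le
  have hmvt := (convex_Ioo a b).mul_sub_le_image_sub_of_le_deriv hψdiff.continuousOn
    (by rwa [interior_Ioo]) hψ'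
  intro x hx
  have hψx_pos : 0 < ψ x := Real.rpow_pos_of_pos (hpos x hx) _
  have hpK : 0 < p * K := mul_pos hp hK
  have hkey : p * K * (x - a) ≤ ψ x := by
    refine le_of_forall_lt fun c hc => ?_
    rcases le_or_gt c 0 with hc0 | hc0
    · exact hc0.trans_lt hψx_pos
    · set l := x - c / (p * K) with hl
      have hl_lt : l < x := by
        rw [hl]
        have : 0 < c / (p * K) := div_pos hc0 hpK
        linarith
      have hal : a < l := by
        have : c / (p * K) < x - a := by
          rw [div_lt_iff₀ hpK]
          linarith
        rw [hl]
        linarith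
      have hlmem : l ∈ Ioo a b := ⟨hal, hl_lt.trans hx.2⟩
      have hstep := hmvt l hlmem x hx hl_lt.le
      have hxl : p * K * (x - l) = c := by
        rw [hl]
        field_simp
        ring
      have hψl_pos : 0 < ψ l := Real.rpow_pos_of_pos (hpos l hlmem) _
      linarith
  have hχeq : χ x = ψ x ^ (-(1 / p)) := by
    simp only [hψ]
    rw [← Real.rpow_mul (hpos x hx).le, show -p * -(1 / p) = 1 by field_simp, Real.rpow_one]
  rw [hχeq]
  exact Real.rpow_le_rpow_of_nonpos (mul_pos hpK (sub_pos.2 hx.1)) hkey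
    (by rw [neg_nonpos]; positivity)

/-- If `χ > 0` is differentiable on `(a, b)`, `-χ'(x) χ(x)^{-(1+q)} ≤ K` there (`q, K > 0`), and
`χ(x) → ∞` as `x ↓ a`, then `(qK(x - a))^{-1/q} ≤ χ(x)` on `(a, b)`: the function `χ^{-q}` has
derivative `≤ qK` and tends to `0` at `a⁺`, so `χ(x)^{-q} ≤ qK(x - a)`. This is the lower-bound
half of the last step of the proof of Slade's Theorem 1.4.1 ("Since `χ(λ) ↑ ∞` as `λ ↓ ν_c`").
[cite: Slade2017, §8.3, Proof of Theorem 1.4.1] -/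
theorem rpow_le_of_le_deriv_rpow {χ : ℝ → ℝ} {a b q K : ℝ} (hq : 0 < q) (hK : 0 < K)
    (hdiff : DifferentiableOn ℝ χ (Ioo a b)) (hpos : ∀ x ∈ Ioo a b, 0 < χ x)
    (hineq : ∀ x ∈ Ioo a b, -(deriv χ x * χ x ^ (-(1 + q))) ≤ K)
    (hdiv : Tendsto χ (𝓝[>] a) atTop) :
    ∀ x ∈ Ioo a b, (q * K * (x - a)) ^ (-(1 / q)) ≤ χ x := by
  set ψ : ℝ → ℝ := fun x => χ x ^ (-q) with hψ
  have hderiv : ∀ x ∈ Ioo a b, HasDerivAt ψ (deriv χ x * (-q) * χ x ^ (-q - 1)) x :=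
    fun x hx =>
      ((hdiff x hx).differentiableAt (Ioo_mem_nhds hx.1 hx.2)).hasDerivAt.rpow_const
        (Or.inl (hpos x hx).ne')
  have hψdiff : DifferentiableOn ℝ ψ (Ioo a b) := fun x hx =>
    (hderiv x hx).differentiableAt.differentiableWithinAt
  have hψ' : ∀ x ∈ interior (Ioo a b), deriv ψ x ≤ q * K := by
    rw [interior_Ioo]
    intro x hx
    rw [(hderiv x hx).deriv]
    have h2 : deriv χ x * (-q) * χ x ^ (-q - 1) = q * -(deriv χ x * χ x ^ (-(1 + q))) := by
      rw [show -q - 1 = -(1 + q) by ring]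
      ring
    rw [h2]
    exact mul_le_mul_of_nonneg_left (hineq x hx) hq.le
  have hmvt := (convex_Ioo a b).image_sub_le_mul_sub_of_deriv_le hψdiff.continuousOn
    (by rwa [interior_Ioo]) hψ'
  intro x hx
  have hψx_pos : 0 < ψ x := Real.rpow_pos_of_pos (hpos x hx) _
  have hqK : 0 < q * K := mul_pos hq hK
  have hkey : ψ x ≤ q * K * (x - a) := by
    refine le_of_forall_pos_lt_add fun δ hδ => ?_
    have hψt : Tendsto ψ (𝓝[>] a) (𝓝 0) := (tendsto_rpow_neg_atTop hq).comp hdiv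
    have h1 : ∀ᶠ l in 𝓝[>] a, ψ l < δ := hψt.eventually (eventually_lt_nhds hδ)
    have h2 : ∀ᶠ l in 𝓝[>] a, l ∈ Ioo a x := Ioo_mem_nhdsGT hx.1
    obtain ⟨l, hl1, hl2⟩ := (h1.and h2).exists
    have hlmem : l ∈ Ioo a b := ⟨hl2.1, hl2.2.trans hx.2⟩
    have hstep := hmvt l hlmem x hx hl2.2.le
    have hmono : q * K * (x - l) ≤ q * K * (x - a) :=
      mul_le_mul_of_nonneg_left (by linarith [hl2.1]) hqK.le
    linarith
  have hχeq : χ x = ψ x ^ (-(1 / q)) := by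
    simp only [hψ]
    rw [← Real.rpow_mul (hpos x hx).le, show -q * -(1 / q) = 1 by field_simp, Real.rpow_one]
  rw [hχeq]
  exact Real.rpow_le_rpow_of_nonpos hψx_pos hkey (by rw [neg_nonpos]; positivity)

/-! ### The conclusions of §8.2–§8.3 consumed by the final step (named fact) -/

/-- **Slade, §8.2–§8.3: the infinite-volume susceptibility near the critical point and its
differential inequality** (named fact, not proved here; it is the output of the renormalisation
group analysis of §5–§8). In the setting of Theorem 1.4.1 — `d = 1,2,3`, `α = (d+ε)/2`, `L`
large then `ε` small, `s̄ ≍ ε`, `g ∈ [63/64 s̄, 65/64 s̄]`, spin case `n ≥ 1` — there are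
`ν_c = ν_c(g;n)`, `η > 0` and the function `ν ↦ χ(g,ν;n)` such that:
(i) for every `ν ∈ (ν_c, ν_c + η]` the infinite-volume limit
`χ(g,ν;n) = lim_{N→∞} n⁻¹Σ_{x∈Λ_N}⟨φ₀·φ_x⟩_{g,ν,N}` exists (Proposition 8.2.2: "the limits
`χ̂ = lim_{N→∞} χ̂_N(m², ν₀ᶜ(m²))` … exist", for `m² ∈ (0, δ]`, with `χ_N(g, ν₀ + m²) = χ̂_N(m², g, ν₀)`
(§4.1, last display) and, from the proof of Theorem 8.3.1, `{ν*(m²) = ν₀ᶜ(m²) + m² : m² ∈ [0,δ]}`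
"is a closed interval" `[ν_c, ν_c + η]` with `η > 0`, `ν_c = lim_{m²↓0} ν*(m²)` (§8.3, definition
of `ν_c`));
(ii) `χ` is differentiable in `ν` on `(ν_c, ν_c + η)` ("the limit and derivative can be
interchanged, and `χ̂'` is in fact the derivative of `χ̂`", end of proof of Proposition 8.2.2;
"`∂χ_N/∂ν(g, ν*) = χ̂'_N(m², g, ν₀ᶜ)`", after Remark 8.2.3);
(iii) `χ > 0` there (`χ̂ = m⁻²(1 + O(s̄))`, Proposition 8.2.2, first display) and
`-χ(ν*)^{-2+γ̂ε/α+O(ε²)} ∂χ/∂ν(ν*) ≍ 1`, `γ̂ = (n+2)/(n+8)` (the second display following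
Remark 8.2.3, obtained from the first: "there is a constant `c` such that
`c⁻¹m^{-4+2γ̂ε/α+cε²} ≤ -∂χ/∂ν(ν*) ≤ cm^{-4+2γ̂ε/α-cε²}`"), rendered literally: the exponent is
`-2 + γ̂ε/α + r` for some `|r| ≤ Cε²` (possibly depending on `ν`), and the two-sided bound has
constant `C`;
(iv) "the susceptibility `χ(g,ν)` diverges to infinity as `ν ↓ ν_c`" (Theorem 8.3.1).
Quantifier prefix and READING of the constants (`c` of `s̄ ≍ ε` and `C` uniform in `ε, g, ν`;
dependent on `d, n, L`) as in `Slade2017_thm141`; cf. the convention for `O(·)` opening §8.1: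
"for some positive `δ` and `c`, and for all `ε ∈ (0,δ]`". Not transcribed: `n = 0`; the formulas
`χ̂ = m⁻² - ν_∞m⁻⁴`, `χ̂' = -ν'_∞m⁻⁴`; `∂χ/∂ν(ν*) < 0` (third display after Remark 8.2.3, a
consequence of (iii));
`ν_c = -(n+2)C₀₀(0)g(1+O(g))`.
[cite: Slade2017, Proposition 8.2.2, second display after Remark 8.2.3, Theorem 8.3.1 and its proof] -/
def Slade2017_susceptibilityDiffIneq : Prop :=
  ∀ (d n : ℕ), (d = 1 ∨ d = 2 ∨ d = 3) → 1 ≤ n →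
    ∃ L₀ : ℕ, ∀ L : ℕ, L₀ ≤ L →
      ∃ ε₀ c C : ℝ, 0 < ε₀ ∧ 0 < c ∧ 0 < C ∧
        ∀ ε : ℝ, 0 < ε → ε < ε₀ →
          ∃ s : ℝ, ε / c ≤ s ∧ s ≤ c * ε ∧
            ∀ g : ℝ, 63 / 64 * s ≤ g → g ≤ 65 / 64 * s →
              ∃ νc η : ℝ, 0 < η ∧ ∃ χ : ℝ → ℝ,
                (∀ ν ∈ Ioc νc (νc + η), HasSusceptibility d n L ((d + ε) / 2) g ν (χ ν)) ∧
                DifferentiableOn ℝ χ (Ioo νc (νc + η)) ∧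
                (∀ ν ∈ Ioo νc (νc + η), 0 < χ ν ∧
                  ∃ r : ℝ, |r| ≤ C * ε ^ 2 ∧
                    C⁻¹ ≤ -(χ ν ^ (-2 + ((n : ℝ) + 2) / ((n : ℝ) + 8) * (ε / ((d + ε) / 2)) + r) *
                        deriv χ ν) ∧
                    -(χ ν ^ (-2 + ((n : ℝ) + 2) / ((n : ℝ) + 8) * (ε / ((d + ε) / 2)) + r) *
                        deriv χ ν) ≤ C) ∧
                Tendsto χ (𝓝[>] νc) atTop

/-! ### Theorem 1.4.1 from §8.2–§8.3: the final integration step, proved -/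

/-- Elementary bookkeeping for the exponents: for `x ≤ 1/2`, `1/(1-x) ≤ 1 + x + 2x²`
(indeed `(1-x)(1+x+2x²) - 1 = x²(1-2x) ≥ 0`). [folklore] -/
theorem one_div_one_sub_le {x : ℝ} (hx : x ≤ 1 / 2) :
    1 / (1 - x) ≤ 1 + x + 2 * x ^ 2 := by
  rw [div_le_iff₀ (by linarith)]
  nlinarith [mul_nonneg (sq_nonneg x) (by linarith : (0 : ℝ) ≤ 1 - 2 * x)]

/-- Elementary bookkeeping for the exponents: for `y < 1`, `1 + y ≤ 1/(1-y)`. [folklore] -/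
theorem one_add_le_one_div_one_sub {y : ℝ} (hy : y < 1) : 1 + y ≤ 1 / (1 - y) := by
  rw [le_div_iff₀ (by linarith)]
  nlinarith [sq_nonneg y]

/-- Bookkeeping: the upper exponent `1/(1 - θ - Cε²) ≤ 1 + θ + (4C² + C + 17)ε²` when
`0 ≤ θ ≤ 2ε`, `ε ≤ 1`, `θ + Cε² ≤ 1/2`. [folklore] -/
theorem exponent_upper_bookkeeping {C ε θ : ℝ} (hC : 0 < C) (hε : 0 < ε) (hε1 : ε ≤ 1)
    (hθ0 : 0 ≤ θ) (hθ2 : θ ≤ 2 * ε) (hθκ : θ + C * ε ^ 2 ≤ 1 / 2) :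
    1 / (1 - θ - C * ε ^ 2) ≤ 1 + θ + (4 * C ^ 2 + C + 17) * ε ^ 2 := by
  have hκ0 : 0 ≤ C * ε ^ 2 := by positivity
  have h1 : 1 / (1 - θ - C * ε ^ 2) ≤ 1 + (θ + C * ε ^ 2) + 2 * (θ + C * ε ^ 2) ^ 2 := by
    have := one_div_one_sub_le (x := θ + C * ε ^ 2) hθκ
    convert this using 2
    ring
  have h3 : (θ + C * ε ^ 2) ^ 2 ≤ 2 * θ ^ 2 + 2 * (C * ε ^ 2) ^ 2 := by
    linarith [sq_nonneg (θ - C * ε ^ 2)]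
  have h4 : θ ^ 2 ≤ 4 * ε ^ 2 := by
    have := pow_le_pow_left₀ hθ0 hθ2 2
    linarith
  have hε42 : ε ^ 4 ≤ ε ^ 2 := pow_le_pow_of_le_one hε.le hε1 (by norm_num)
  have h5 : (C * ε ^ 2) ^ 2 ≤ C ^ 2 * ε ^ 2 := by
    calc (C * ε ^ 2) ^ 2 = C ^ 2 * ε ^ 4 := by ring
      _ ≤ C ^ 2 * ε ^ 2 := mul_le_mul_of_nonneg_left hε42 (by positivity)
  have h6 : (0 : ℝ) ≤ ε ^ 2 := by positivity
  linarith

/-- Bookkeeping: the lower exponent `1 + θ - (4C² + C + 17)ε² ≤ 1/(1 - θ + Cε²)` when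
`θ ≤ 1/2`, `C > 0`. [folklore] -/
theorem exponent_lower_bookkeeping {C ε θ : ℝ} (hC : 0 < C) (hθ : θ ≤ 1 / 2) :
    1 + θ - (4 * C ^ 2 + C + 17) * ε ^ 2 ≤ 1 / (1 - θ + C * ε ^ 2) := by
  have hκ0 : 0 ≤ C * ε ^ 2 := by positivity
  have h1 : 1 + (θ - C * ε ^ 2) ≤ 1 / (1 - θ + C * ε ^ 2) := by
    have := one_add_le_one_div_one_sub (y := θ - C * ε ^ 2) (by linarith)
    convert this using 2
    ring
  have h2 : C * ε ^ 2 ≤ (4 * C ^ 2 + C + 17) * ε ^ 2 :=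
    mul_le_mul_of_nonneg_right (by linarith [sq_nonneg C]) (sq_nonneg ε)
  linarith

/-- Bookkeeping: the upper prefactor `(pC⁻¹)^{-1/p} ≤ 4C² + C + 17` for `p ≥ 1/2`. [folklore] -/
theorem prefactor_upper_bookkeeping {C p : ℝ} (hC : 0 < C) (hp : 1 / 2 ≤ p) :
    (p * C⁻¹) ^ (-(1 / p)) ≤ 4 * C ^ 2 + C + 17 := by
  have hp_pos : 0 < p := by linarith
  have hpC : 0 < p * C⁻¹ := mul_pos hp_pos (inv_pos.2 hC)
  rcases le_or_gt 1 (p * C⁻¹) with hle | hlt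
  · calc (p * C⁻¹) ^ (-(1 / p)) ≤ 1 :=
          Real.rpow_le_one_of_one_le_of_nonpos hle (by rw [neg_nonpos]; positivity)
      _ ≤ 4 * C ^ 2 + C + 17 := by linarith [sq_nonneg C, hC.le]
  · have h2p : -2 ≤ -(1 / p) := by
      rw [neg_le_neg_iff, div_le_iff₀ hp_pos]
      linarith
    calc (p * C⁻¹) ^ (-(1 / p)) ≤ (p * C⁻¹) ^ (-2 : ℝ) :=
          Real.rpow_le_rpow_of_exponent_ge hpC hlt.le h2p
      _ = ((p * C⁻¹) ^ 2)⁻¹ := by rw [Real.rpow_neg hpC.le, Real.rpow_two]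
      _ = (C / p) ^ 2 := by
          rw [← inv_pow]
          congr 1
          rw [mul_inv, inv_inv, mul_comm, div_eq_mul_inv]
      _ ≤ (2 * C) ^ 2 := by
          apply pow_le_pow_left₀ (by positivity)
          rw [div_le_iff₀ hp_pos]
          have := mul_le_mul_of_nonneg_left hp hC.le
          linarith
      _ ≤ 4 * C ^ 2 + C + 17 := by linarith [sq_nonneg C, hC.le]

/-- Bookkeeping: the lower prefactor `(4C² + C + 17)⁻¹ ≤ (qC)^{-1/q}` for `1/2 ≤ q ≤ 5/4`.
[folklore] -/
theorem prefactor_lower_bookkeeping {C q : ℝ} (hC : 0 < C) (hq : 1 / 2 ≤ q) (hq' : q ≤ 5 / 4) :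
    (4 * C ^ 2 + C + 17)⁻¹ ≤ (q * C) ^ (-(1 / q)) := by
  have hq_pos : 0 < q := by linarith
  have hqC : 0 < q * C := mul_pos hq_pos hC
  rcases le_or_gt (q * C) 1 with hle | hlt
  · calc (4 * C ^ 2 + C + 17)⁻¹ ≤ 1 := by
          apply inv_le_one_of_one_le₀
          linarith [sq_nonneg C, hC.le]
      _ ≤ (q * C) ^ (-(1 / q)) :=
          Real.one_le_rpow_of_pos_of_le_one_of_nonpos hqC hle (by rw [neg_nonpos]; positivity)
  · have h2q : -2 ≤ -(1 / q) := by
      rw [neg_le_neg_iff, div_le_iff₀ hq_pos]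
      linarith
    have hq2 : q ^ 2 * C ^ 2 ≤ (5 / 4) ^ 2 * C ^ 2 :=
      mul_le_mul_of_nonneg_right (pow_le_pow_left₀ hq_pos.le hq' 2) (sq_nonneg C)
    calc (4 * C ^ 2 + C + 17)⁻¹ ≤ ((q * C) ^ 2)⁻¹ := by
          apply inv_anti₀ (by positivity)
          rw [mul_pow]
          linarith [hC.le, sq_nonneg C]
      _ = (q * C) ^ (-2 : ℝ) := by
          rw [Real.rpow_neg hqC.le, Real.rpow_two]
      _ ≤ (q * C) ^ (-(1 / q)) := Real.rpow_le_rpow_of_exponent_le hlt.le h2q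

/-- The analytic core of the final step at one point `ν_c + t`: from `χ ≥ 1`, differentiability,
the differential inequality `-χ^{-2+θ+r}χ' ∈ [C⁻¹, C]` (`|r| ≤ κ`) on `(ν_c, ν_c + η)` and
divergence at `ν_c⁺`, the two power-law bounds with exponents `1/(1 - θ ∓ κ)`.
[cite: Slade2017, §8.3, Proof of Theorem 1.4.1] -/
theorem susceptibility_two_sided_core {χ : ℝ → ℝ} {a η C θ κ : ℝ} (hC : 0 < C)
    (hp : 0 < 1 - θ - κ) (hq : 0 < 1 - θ + κ)
    (hdiff : DifferentiableOn ℝ χ (Ioo a (a + η))) (hone : ∀ x ∈ Ioo a (a + η), 1 ≤ χ x)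
    (hode : ∀ x ∈ Ioo a (a + η), ∃ r : ℝ, |r| ≤ κ ∧
      C⁻¹ ≤ -(χ x ^ (-2 + θ + r) * deriv χ x) ∧ -(χ x ^ (-2 + θ + r) * deriv χ x) ≤ C)
    (hdiv : Tendsto χ (𝓝[>] a) atTop) {t : ℝ} (ht : 0 < t) (htη : t < η) :
    ((1 - θ + κ) * C * t) ^ (-(1 / (1 - θ + κ))) ≤ χ (a + t) ∧
      χ (a + t) ≤ ((1 - θ - κ) * C⁻¹ * t) ^ (-(1 / (1 - θ - κ))) := by
  have hpos : ∀ x ∈ Ioo a (a + η), 0 < χ x := fun x hx => one_pos.trans_le (hone x hx)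
  -- sign of `χ'` and the two one-sided bounds with uniform exponents
  have haux : ∀ x ∈ Ioo a (a + η), ∃ r : ℝ, |r| ≤ κ ∧ 0 ≤ -deriv χ x ∧
      C⁻¹ ≤ χ x ^ (-2 + θ + r) * -deriv χ x ∧ χ x ^ (-2 + θ + r) * -deriv χ x ≤ C := by
    intro x hx
    obtain ⟨r, hr, hlo, hhi⟩ := hode x hx
    rw [← mul_neg] at hlo hhi
    have hχe_pos : 0 < χ x ^ (-2 + θ + r) := Real.rpow_pos_of_pos (hpos x hx) _
    exact ⟨r, hr, (pos_of_mul_pos_right ((inv_pos.2 hC).trans_le hlo) hχe_pos.le).le, hlo, hhi⟩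
  have hineq1 : ∀ x ∈ Ioo a (a + η), C⁻¹ ≤ -(deriv χ x * χ x ^ (-(1 + (1 - θ - κ)))) := by
    intro x hx
    obtain ⟨r, hr, hneg, hlo, -⟩ := haux x hx
    have hexp : χ x ^ (-2 + θ + r) ≤ χ x ^ (-(1 + (1 - θ - κ))) :=
      Real.rpow_le_rpow_of_exponent_le (hone x hx) (by linarith [le_abs_self r])
    calc C⁻¹ ≤ χ x ^ (-2 + θ + r) * -deriv χ x := hlo
      _ ≤ χ x ^ (-(1 + (1 - θ - κ))) * -deriv χ x := mul_le_mul_of_nonneg_right hexp hneg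
      _ = -(deriv χ x * χ x ^ (-(1 + (1 - θ - κ)))) := by ring
  have hineq2 : ∀ x ∈ Ioo a (a + η), -(deriv χ x * χ x ^ (-(1 + (1 - θ + κ)))) ≤ C := by
    intro x hx
    obtain ⟨r, hr, hneg, -, hhi⟩ := haux x hx
    have hexp : χ x ^ (-(1 + (1 - θ + κ))) ≤ χ x ^ (-2 + θ + r) :=
      Real.rpow_le_rpow_of_exponent_le (hone x hx) (by linarith [neg_abs_le r])
    calc -(deriv χ x * χ x ^ (-(1 + (1 - θ + κ))))
          = χ x ^ (-(1 + (1 - θ + κ))) * -deriv χ x := by ring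
      _ ≤ χ x ^ (-2 + θ + r) * -deriv χ x := mul_le_mul_of_nonneg_right hexp hneg
      _ ≤ C := hhi
  have hxmem : a + t ∈ Ioo a (a + η) := ⟨by linarith, by linarith⟩
  have hup := le_rpow_of_deriv_rpow_le hp (inv_pos.2 hC) hdiff hpos hineq1 (a + t) hxmem
  have hlow := rpow_le_of_le_deriv_rpow hq hC hdiff hpos hineq2 hdiv (a + t) hxmem
  rw [add_sub_cancel_left] at hup hlow
  exact ⟨hlow, hup⟩

/-- **Slade's "Proof of Theorem 1.4.1" (end of §8.3), formalised**: the conclusions of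
§8.2–§8.3 (`Slade2017_susceptibilityDiffIneq`) imply Theorem 1.4.1, first display, `n ≥ 1`
(`Slade2017_thm141`). "Integration of [the second display after Remark 8.2.3] over the interval
`[λ,ν]` gives
`χ(ν)^{-1+γ̂ε/α+O(ε²)} - χ(λ)^{-1+γ̂ε/α+O(ε²)} ≍ ν - λ`. Since `χ(λ) ↑ ∞` as `λ ↓ ν_c`, this gives
`χ(ν) ≍ (ν-ν_c)^{-1/(1-γ̂ε/α+O(ε²))} ≍ (ν-ν_c)^{-(1+γ̂ε/α+O(ε²))}`." Constants: with `C` the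
constant of the differential inequality, `ε₀` is shrunk to `min ε₀ (min (1/8) (1/(4C)))` (so that
`γ̂ε/α + Cε² ≤ 1/2`), `t₀ = min η₁ 1` where `χ ≥ 1` on `(ν_c, ν_c + η₁)`, and the theorem holds
with `C' = 4C² + C + 17`. [cite: Slade2017, §8.3, Proof of Theorem 1.4.1] -/
theorem Slade2017_thm141_of_susceptibilityDiffIneq (h : Slade2017_susceptibilityDiffIneq) :
    Slade2017_thm141 := by
  intro d n hd hn
  obtain ⟨L₀, hL₀⟩ := h d n hd hn
  refine ⟨L₀, fun L hL => ?_⟩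
  obtain ⟨ε₀, c, C, hε₀, hc, hC, hmain⟩ := hL₀ L hL
  clear hL₀
  -- the new constants
  have hC1 : (0 : ℝ) < 1 / (4 * C) := by positivity
  refine ⟨min ε₀ (min (1 / 8) (1 / (4 * C))), c, 4 * C ^ 2 + C + 17,
    lt_min hε₀ (lt_min (by norm_num) hC1), hc, by positivity, fun ε hε hεlt => ?_⟩
  have hεε₀ : ε < ε₀ := hεlt.trans_le (min_le_left _ _)
  have hε8 : ε ≤ 1 / 8 := (hεlt.trans_le ((min_le_right _ _).trans (min_le_left _ _))).le
  have hε4C : ε ≤ 1 / (4 * C) :=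
    (hεlt.trans_le ((min_le_right _ _).trans (min_le_right _ _))).le
  have hε1 : ε ≤ 1 := hε8.trans (by norm_num)
  have hCε : C * ε ≤ 1 / 4 := by
    calc C * ε ≤ C * (1 / (4 * C)) := mul_le_mul_of_nonneg_left hε4C hC.le
      _ = 1 / 4 := by rw [mul_one_div, mul_comm 4 C, ← div_div, div_self hC.ne']
  obtain ⟨s, hs1, hs2, hg⟩ := hmain ε hε hεε₀
  clear hmain
  refine ⟨s, hs1, hs2, fun g hg1 hg2 => ?_⟩
  obtain ⟨νc, η, hη, χ, hsus, hdiff, hode, hdiv⟩ := hg g hg1 hg2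
  clear hg
  -- a right neighbourhood of `νc` on which `χ ≥ 1`
  have hev : ∀ᶠ ν in 𝓝[>] νc, 1 ≤ χ ν := hdiv.eventually (eventually_ge_atTop 1)
  obtain ⟨u, hu, husub⟩ := mem_nhdsGT_iff_exists_Ioo_subset.1 hev
  have hu' : νc < u := hu
  have hη₁ : 0 < min η (u - νc) := lt_min hη (sub_pos.2 hu')
  have hη₁η : min η (u - νc) ≤ η := min_le_left _ _
  have hη₁u : min η (u - νc) ≤ u - νc := min_le_right _ _
  refine ⟨νc, min (min η (u - νc)) 1, lt_min hη₁ one_pos, fun t ht htlt => ?_⟩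
  have htη₁ : t < min η (u - νc) := htlt.trans_le (min_le_left _ _)
  have ht1 : t < 1 := htlt.trans_le (min_le_right _ _)
  -- the exponents `θ = γ̂ε/α`, `κ = Cε²`
  have hd1 : (1 : ℝ) ≤ d := by
    rcases hd with rfl | rfl | rfl <;> norm_num
  have hθ0 : 0 ≤ ((n : ℝ) + 2) / ((n : ℝ) + 8) * (ε / ((d + ε) / 2)) := by positivity
  have hθ2 : ((n : ℝ) + 2) / ((n : ℝ) + 8) * (ε / ((d + ε) / 2)) ≤ 2 * ε := by
    have h1 : ((n : ℝ) + 2) / ((n : ℝ) + 8) ≤ 1 := by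
      rw [div_le_one (by positivity)]
      linarith
    have h2 : ε / ((d + ε) / 2) ≤ 2 * ε := by
      rw [div_le_iff₀ (by positivity)]
      nlinarith
    calc ((n : ℝ) + 2) / ((n : ℝ) + 8) * (ε / ((d + ε) / 2))
        ≤ 1 * (2 * ε) := mul_le_mul h1 h2 (by positivity) zero_le_one
      _ = 2 * ε := one_mul _
  generalize hθ_def : ((n : ℝ) + 2) / ((n : ℝ) + 8) * (ε / ((d + ε) / 2)) = θ at hθ0 hθ2
  have hγ : gammaOne n ε ((d + ε) / 2) = 1 + θ := by rw [← hθ_def, gammaOne]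
  have hκ4 : C * ε ^ 2 ≤ 1 / 4 := by
    calc C * ε ^ 2 = C * ε * ε := by ring
      _ ≤ 1 / 4 * 1 := mul_le_mul hCε hε1 hε.le (by norm_num)
      _ = 1 / 4 := by norm_num
  have hκ0 : 0 ≤ C * ε ^ 2 := by positivity
  have hθκ : θ + C * ε ^ 2 ≤ 1 / 2 := by linarith
  -- the analytic core on `(νc, νc + η₁)`
  have hsub : Ioo νc (νc + min η (u - νc)) ⊆ Ioo νc (νc + η) :=
    Ioo_subset_Ioo le_rfl (by linarith)
  have hone : ∀ x ∈ Ioo νc (νc + min η (u - νc)), 1 ≤ χ x := fun x hx =>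
    husub ⟨hx.1, by linarith [hx.2]⟩
  have hode' : ∀ x ∈ Ioo νc (νc + min η (u - νc)), ∃ r : ℝ, |r| ≤ C * ε ^ 2 ∧
      C⁻¹ ≤ -(χ x ^ (-2 + θ + r) * deriv χ x) ∧ -(χ x ^ (-2 + θ + r) * deriv χ x) ≤ C := by
    intro x hx
    obtain ⟨-, r, hr⟩ := hode x (hsub hx)
    rw [hθ_def] at hr
    exact ⟨r, hr⟩
  obtain ⟨hlow, hup⟩ := susceptibility_two_sided_core hC (by linarith) (by linarith)
    (hdiff.mono hsub) hone hode' hdiv ht htη₁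
  have hp_half : 1 / 2 ≤ 1 - θ - C * ε ^ 2 := by linarith
  have hq_half : 1 / 2 ≤ 1 - θ + C * ε ^ 2 := by linarith
  have hq_54 : 1 - θ + C * ε ^ 2 ≤ 5 / 4 := by linarith
  have hqC : 0 ≤ (1 - θ + C * ε ^ 2) * C := by positivity
  have hpC : 0 ≤ (1 - θ - C * ε ^ 2) * C⁻¹ := mul_nonneg (by linarith) (inv_pos.2 hC).le
  refine ⟨χ (νc + t), hsus _ ⟨by linarith, by linarith⟩, ?_, ?_⟩
  · -- lower bound: `C'⁻¹ t^{-(1+θ-C'ε²)} ≤ (qC)^{-1/q} t^{-1/q} ≤ χ`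
    rw [hγ]
    rw [Real.mul_rpow hqC ht.le] at hlow
    refine le_trans (mul_le_mul (prefactor_lower_bookkeeping hC hq_half hq_54) ?_
      (Real.rpow_nonneg ht.le _) (Real.rpow_nonneg hqC _)) hlow
    refine Real.rpow_le_rpow_of_exponent_ge ht ht1.le ?_
    rw [neg_le_neg_iff]
    exact exponent_lower_bookkeeping hC (by linarith)
  · -- upper bound: `χ ≤ (pC⁻¹)^{-1/p} t^{-1/p} ≤ C' t^{-(1+θ+C'ε²)}`
    rw [hγ]
    rw [Real.mul_rpow hpC ht.le] at hup
    refine hup.trans (mul_le_mul (prefactor_upper_bookkeeping hC hp_half) ?_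
      (Real.rpow_nonneg ht.le _) (by positivity))
    refine Real.rpow_le_rpow_of_exponent_ge ht ht1.le ?_
    rw [neg_le_neg_iff]
    exact exponent_upper_bookkeeping hC hε hε1 hθ0 hθ2 hθκ

/-! ### Non-vacuity of the analytic clauses of the named fact (barrier audit, D-0021)

The hypothesis `Slade2017_susceptibilityDiffIneq` of the reduction couples a model clause
((i): `HasSusceptibility`, the infinite-volume limit of the transcribed torus susceptibilities)
with purely analytic clauses ((ii) differentiability, (iii) positivity and the two-sided bound on
`-χ^{-2+γ̂ε/α+r}χ'` with `|r| ≤ Cε²`, (iv) divergence at `ν_c⁺`). The two theorems below certify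
that (ii)–(iv) are jointly satisfiable in their literal shape, by the pure power law
`χ(ν) = (ν - ν_c)^{-1/(1-θ)}`, `θ = γ̂ε/α`, with ONE constant chosen before `ε` (as the fact's
quantifier prefix demands): the analytic part of the hypothesis is not self-contradictory, and the
only exponent compatible with `r ≡ 0` is `1/(1-θ) = 1 + θ + O(θ²)`, the exponent of Theorem 1.4.1.
Clause (i) is about the model and is not touched. -/

/-- **Power-law witness for clauses (ii)–(iv).** For `0 ≤ θ < 1`, any `κ ≥ 0` and ANY constant
`C ≥ 1/(1-θ)`, the function `χ(ν) = (ν - a)^{-1/(1-θ)}` is differentiable and positive on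
`(a, a + η)`, satisfies `C⁻¹ ≤ -χ(ν)^{-2+θ+r}χ'(ν) ≤ C` there with `r = 0` (in fact
`-χ^{-2+θ}χ' ≡ 1/(1-θ)`: for `χ = (ν-a)^{-γ}` one has `-χ^{-2+θ}χ' = γ(ν-a)^{γ(1-θ)-1}`, constant
iff `γ(1-θ) = 1`), and `χ → ∞` as `ν ↓ a`. The clauses are monotone in `C`, whence the freedom
`C ≥ 1/(1-θ)`. [folklore] -/
theorem powerLaw_analytic_clauses {θ C : ℝ} (hθ0 : 0 ≤ θ) (hθ1 : θ < 1) (hC : 1 / (1 - θ) ≤ C)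
    (a η κ : ℝ) (hκ : 0 ≤ κ) :
    DifferentiableOn ℝ (fun ν : ℝ => (ν - a) ^ (-(1 / (1 - θ)))) (Ioo a (a + η)) ∧
    (∀ ν ∈ Ioo a (a + η), 0 < (ν - a) ^ (-(1 / (1 - θ))) ∧
      ∃ r : ℝ, |r| ≤ κ ∧
        C⁻¹ ≤ -(((ν - a) ^ (-(1 / (1 - θ)))) ^ (-2 + θ + r) *
            deriv (fun ν : ℝ => (ν - a) ^ (-(1 / (1 - θ)))) ν) ∧
        -(((ν - a) ^ (-(1 / (1 - θ)))) ^ (-2 + θ + r) *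
            deriv (fun ν : ℝ => (ν - a) ^ (-(1 / (1 - θ)))) ν) ≤ C) ∧
    Tendsto (fun ν : ℝ => (ν - a) ^ (-(1 / (1 - θ)))) (𝓝[>] a) atTop := by
  set γ : ℝ := 1 / (1 - θ) with hγ_def
  have h1θ : 0 < 1 - θ := sub_pos.2 hθ1
  have hγ_pos : 0 < γ := by positivity
  have hγ1 : 1 ≤ γ := by
    rw [hγ_def, le_div_iff₀ h1θ]
    linarith
  have hC1 : 1 ≤ C := hγ1.trans hC
  -- the derivative at a point `ν > a`
  have hderiv : ∀ ν : ℝ, a < ν →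
      HasDerivAt (fun ν : ℝ => (ν - a) ^ (-γ)) (1 * -γ * (ν - a) ^ (-γ - 1)) ν :=
    fun ν hν => ((hasDerivAt_id ν).sub_const a).rpow_const (Or.inl (sub_pos.2 hν).ne')
  refine ⟨fun ν hν => (hderiv ν hν.1).differentiableAt.differentiableWithinAt, ?_, ?_⟩
  · intro ν hν
    have hpos : 0 < ν - a := sub_pos.2 hν.1
    refine ⟨Real.rpow_pos_of_pos hpos _, 0, by simpa using hκ, ?_⟩
    rw [(hderiv ν hν.1).deriv, add_zero]
    -- `-χ^{-2+θ} χ' = γ (ν - a)^{γ(1-θ) - 1} = γ`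
    have hone : (ν - a) ^ (-γ * (-2 + θ)) * (ν - a) ^ (-γ - 1) = 1 := by
      rw [← Real.rpow_add hpos]
      have hγθ : γ * (1 - θ) = 1 := by
        rw [hγ_def, one_div, inv_mul_cancel₀ h1θ.ne']
      rw [show -γ * (-2 + θ) + (-γ - 1) = 0 by linarith [hγθ], Real.rpow_zero]
    have hid : -(((ν - a) ^ (-γ)) ^ (-2 + θ) * (1 * -γ * (ν - a) ^ (-γ - 1))) = γ := by
      rw [← Real.rpow_mul hpos.le]
      calc -((ν - a) ^ (-γ * (-2 + θ)) * (1 * -γ * (ν - a) ^ (-γ - 1)))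
          = γ * ((ν - a) ^ (-γ * (-2 + θ)) * (ν - a) ^ (-γ - 1)) := by ring
        _ = γ := by rw [hone, mul_one]
    rw [hid]
    exact ⟨(inv_le_one_of_one_le₀ hC1).trans hγ1, hC⟩
  · -- divergence at `a⁺`: `x ↦ x^{-γ}` along `ν - a ↓ 0`
    have hsub : Tendsto (fun ν : ℝ => ν - a) (𝓝[>] a) (𝓝[>] 0) := by
      refine tendsto_nhdsWithin_iff.2 ⟨?_, ?_⟩
      · have := ((continuous_sub_right a).tendsto a).mono_left
          (nhdsWithin_le_nhds (s := Ioi a))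
        simpa using this
      · exact eventually_nhdsWithin_of_forall fun ν hν => mem_Ioi.2 (sub_pos.2 hν)
    exact (tendsto_rpow_neg_nhdsGT_zero (neg_neg_of_pos hγ_pos)).comp hsub

/-- **Clauses (ii)–(iv) of `Slade2017_susceptibilityDiffIneq` in their literal shape, with a
constant chosen before `ε`.** For `d ≥ 1`, every `n`, the constant `C = 2` and EVERY
`ε ∈ (0, 1/4]`, the power law `χ(ν) = (ν - ν_c)^{-1/(1-θ)}` with `θ = (n+2)/(n+8) · ε/α`,
`α = (d+ε)/2` (so `0 ≤ θ ≤ 2ε ≤ 1/2`), satisfies on `(ν_c, ν_c + η)`: differentiability,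
positivity, `∃ r, |r| ≤ Cε² ∧ C⁻¹ ≤ -χ^{-2+θ+r}χ' ≤ C` (with `r = 0`), and `χ → ∞` at `ν_c⁺` —
word for word the conjuncts following the `HasSusceptibility` clause in the named fact, under its
quantifier order (`C` before `ε`; `ν_c`, `η` arbitrary). [folklore] -/
theorem powerLaw_clauses_literal (d n : ℕ) (hd : 1 ≤ d) {ε : ℝ} (hε : 0 < ε) (hε4 : ε ≤ 1 / 4)
    (νc η : ℝ) :
    let C : ℝ := 2
    let θ : ℝ := ((n : ℝ) + 2) / ((n : ℝ) + 8) * (ε / ((d + ε) / 2))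
    let χ : ℝ → ℝ := fun ν => (ν - νc) ^ (-(1 / (1 - θ)))
    DifferentiableOn ℝ χ (Ioo νc (νc + η)) ∧
    (∀ ν ∈ Ioo νc (νc + η), 0 < χ ν ∧
      ∃ r : ℝ, |r| ≤ C * ε ^ 2 ∧
        C⁻¹ ≤ -(χ ν ^ (-2 + ((n : ℝ) + 2) / ((n : ℝ) + 8) * (ε / ((d + ε) / 2)) + r) *
            deriv χ ν) ∧
        -(χ ν ^ (-2 + ((n : ℝ) + 2) / ((n : ℝ) + 8) * (ε / ((d + ε) / 2)) + r) *
            deriv χ ν) ≤ C) ∧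
    Tendsto χ (𝓝[>] νc) atTop := by
  intro C θ χ
  have hd1 : (1 : ℝ) ≤ d := by exact_mod_cast hd
  have hθ0 : 0 ≤ θ := by positivity
  have hθ2 : θ ≤ 2 * ε := by
    have h1 : ((n : ℝ) + 2) / ((n : ℝ) + 8) ≤ 1 := by
      rw [div_le_one (by positivity)]
      linarith
    have h2 : ε / ((d + ε) / 2) ≤ 2 * ε := by
      rw [div_le_iff₀ (by positivity)]
      nlinarith
    calc θ = ((n : ℝ) + 2) / ((n : ℝ) + 8) * (ε / ((d + ε) / 2)) := rfl
      _ ≤ 1 * (2 * ε) := mul_le_mul h1 h2 (by positivity) zero_le_one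
      _ = 2 * ε := one_mul _
  have hθ1 : θ < 1 := by linarith
  have hC : 1 / (1 - θ) ≤ C := by
    show 1 / (1 - θ) ≤ 2
    rw [div_le_iff₀ (by linarith)]
    linarith
  exact powerLaw_analytic_clauses hθ0 hθ1 hC νc η (C * ε ^ 2) (by positivity)

end LongRangePhi4

/-- The barrier `RigorousRGSmallParameter` (= Slade's Theorem 1.4.1, first display, `n ≥ 1`)
follows from the conclusions of §8.2–§8.3 of the paper
(`LongRangePhi4.Slade2017_susceptibilityDiffIneq`) by the final integration step, proved above.
[cite: Slade2017, §8.3, Proof of Theorem 1.4.1] -/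
theorem rigorousRGSmallParameter_of_susceptibilityDiffIneq
    (h : LongRangePhi4.Slade2017_susceptibilityDiffIneq) : RigorousRGSmallParameter :=
  LongRangePhi4.Slade2017_thm141_of_susceptibilityDiffIneq h

end Literature.Barriers.CriticalPhenomena

end
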